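import Mathlib
import Literature.Computability.AlgebraicComplexity.PermanentIrreducible
import Summits.ValiantsHypothesis.ValiantsHypothesis.Theorems.ValuativeGCTValuativeFlipSeedLift

/-!
# Explicit padded-permanent highest-weight vectors: `stub_seedRichness` reduced to an `m`-free
# seed certificate on `per_n`

Wall-breaker axis k9 ("explicit padded-permanent highest-weight vectors for `stub_seedRichness`")
for crux `ValuativeGCT.ValuativeFlip` (stmt-ValiantsHypothesis-12624; the stub is
`Cruxes/ValuativeFlip/Lines/big_cell_semigroup_floor.lean`, `stub_seedRichness`).  Instance of the
seed-lift transfer `psl_seedLift_transfer` (`ValuativeGCTValuativeFlipSeedLift.lean`) for the padded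
permanent:

* `psl_paddedForm_linSubst_per_mem_endOrbit` — for EVERY matrix `A`, the padded form
  `x_top^j · (A · per_n)♯` is an endomorphism-orbit point of G20's padded permanent
  `X₀₀^j per_n = paddedPerFormLex ℂ n (n + j)` (so it lies in `Δ_{n+j}(X₀₀^j per_n)`).
* `psl_apply_top_le_one_rowFrozen` — the generic matrix with its top row frozen to
  `(0, …, 0, A_{top,top})` keeps `A · per_n` linear in `x_top` (the permanent is multilinear,
  `psl_apply_le_one_of_mem_support_paddedPerFormLex_self`).
* `psl_paddedPer_seedLift` — EXPLICIT PADDED HIGHEST-WEIGHT VECTORS: seeds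
  `F_i ∈ HWV_{μ*}(ℂ[Sym^n ℂ^{n²}])` whose generic values on the frozen family `A · per_n` are
  algebraically independent lift (`liftHWV n j`) to algebraically independent highest-weight vectors
  of the one weight `(μ♯(n+j))*` in `ℂ[Δ_{n+j}(X₀₀^j per_n)]`, for every `j`.
* `psl_seedRichness_of_seedCertificate` — the conclusion is VERBATIM `stub_seedRichness`; the
  hypothesis is the `m`-free seed certificate at size `n` (richness `D ≥ n⁴/4`).  This is what the
  axis reduces the stub to.
* `psl_seedLift_transfer_weight`, `psl_paddedPer_seedLift_weight`,
  `psl_seedRichness_of_weightCertificate` — the same with an ARBITRARY common weight `χ` of size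
  `-n d` in place of a partition weight (weights add as functions: seed families of several weights
  are first packaged into one weight by products, `algebraicIndependent_monomial` of the sibling file
  `ValuativeGCTValuativeFlipSeedTransfer.lean`, axis k13, which also has the Jacobian criterion
  `algebraicIndependent_of_det_pderiv_ne_zero` for certifying the hypothesis computationally).

Sources: Mulmuley–Sohoni 2001 §4–§5; Ikenmeyer–Panova 2017 Prop. 2.6(b); Bürgisser–Ikenmeyer–Panova
2019 §5; Kadish–Landsberg 2014; folklore.
-/

set_option linter.dupNamespace false

namespace Summit.ValiantsHypothesis.ValiantsHypothesis.Theorems.ValuativeFlip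

open MvPolynomial
open scoped BigOperators Matrix
open Literature.NumberTheory.DiophantineGeometry Literature.Computability.AlgebraicComplexity

noncomputable section

/-! ### The padded permanent: explicit padded highest-weight vectors from `per_n` seeds -/

section PaddedPermanent

open Literature.Computability.Complexity (liftHWV paddedForm segEmb rowLift partitionWeightLex
  topMatIdx le_topMatIdx paddedPerFormLex_eq)

/-- A substitution of variables by LINEAR FORMS is a linear substitution by the matrix of their
coefficients, so its value on `f` lies in the endomorphism orbit `End · f`
(`sum_coeff_single_smul_X`).  Mulmuley–Sohoni 2001 §4. [folklore] -/
theorem psl_aeval_linear_mem_endOrbit {σ : Type*} [Fintype σ] [DecidableEq σ]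
    (φ : σ → MvPolynomial σ ℂ) (hφ : ∀ v, (φ v).IsHomogeneous 1) (f : MvPolynomial σ ℂ) :
    aeval φ f ∈ endOrbit σ ℂ f := by
  classical
  refine ⟨fun p v => coeff (Finsupp.single p 1) (φ v), ?_⟩
  show linSubst σ ℂ (fun p v => coeff (Finsupp.single p 1) (φ v)) f = aeval φ f
  suffices h : linSubst σ ℂ (fun p v => coeff (Finsupp.single p 1) (φ v)) = aeval φ from
    congrArg (fun g : MvPolynomial σ ℂ →ₐ[ℂ] MvPolynomial σ ℂ => g f) h
  refine MvPolynomial.algHom_ext fun v => ?_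
  rw [linSubst_X, aeval_X]
  exact sum_coeff_single_smul_X (hφ v)

/-- **Padded substitution instances of `per_n` are endomorphism-orbit points of the padded
permanent.**  For EVERY matrix `A` (invertible or not), the padded form
`x_top^j · (A · per_n)♯ ∈ Sym^{n+j} ℂ^{(n+j)²}` (inner form `paddedPerFormLex ℂ n n = per_n`, placed on
the final lexicographic segment, `paddedForm`) is `E · (X₀₀^j per_n)` for an endomorphism `E` of
`ℂ^{(n+j)²}` (`paddedPerFormLex ℂ n (n+j)`, G20's padded permanent on the bottom-right block):
send the padding variable `X₀₀` to `x_top`, each block variable to the corresponding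
(`A`-substituted, segment-renamed) linear form, every other variable to `x_top`; both sides are then
`x_top^j · per_n(linear forms)` (`rename_perPoly_equiv` identifies the two copies of `per_n`).
Hence (`endOrbit_subset_orbitClosure`) all these padded forms lie in `Δ_{n+j}(X₀₀^j per_n)`, and
every element of `I(GL · X₀₀^j per_n)` vanishes at them (`psl_aeval_formCoeff_linSubst_eq_zero_of_mem`).
Mulmuley–Sohoni 2001 §4; IP 2017 §2.2; BIP 2019 §1. [folklore] -/
theorem psl_paddedForm_linSubst_per_mem_endOrbit (n j : ℕ) [NeZero n] [NeZero (n + j)]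
    (A : Matrix (MatIdx n) (MatIdx n) ℂ) :
    paddedForm n j (linSubst (MatIdx n) ℂ A (paddedPerFormLex ℂ n n)) ∈
      endOrbit (MatIdx (n + j)) ℂ (paddedPerFormLex ℂ n (n + j)) := by
  classical
  -- the two block index types and an identification of the two copies of `per_n`
  let ιN : BlockIdx n (n + j) × BlockIdx n (n + j) → MatIdx (n + j) :=
    fun ab => toLex ((ab.1 : Fin (n + j)), (ab.2 : Fin (n + j)))
  let ιn : BlockIdx n n × BlockIdx n n → MatIdx n := fun ab => toLex ((ab.1 : Fin n), (ab.2 : Fin n))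
  have hcard : Fintype.card (BlockIdx n n) = Fintype.card (BlockIdx n (n + j)) := by
    rw [card_blockIdx (le_refl n), card_blockIdx (Nat.le_add_right n j)]
  let e : BlockIdx n n ≃ BlockIdx n (n + j) := Fintype.equivOfCardEq hcard
  let θ : BlockIdx n n × BlockIdx n n → MatIdx (n + j) := ιN ∘ Prod.map e e
  have hθ : Function.Injective θ := by
    intro ab ab' h
    have h' : ((e ab.1 : Fin (n + j)), (e ab.2 : Fin (n + j))) = ((e ab'.1 : Fin (n + j)), (e ab'.2 : Fin (n + j))) :=
      toLex.injective h
    obtain ⟨h1, h2⟩ := Prod.mk.injEq _ _ _ _ ▸ h'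
    exact Prod.ext (e.injective (Subtype.ext h1)) (e.injective (Subtype.ext h2))
  -- the linear forms
  let ψ : BlockIdx n n × BlockIdx n n → MvPolynomial (MatIdx (n + j)) ℂ :=
    fun ab => rename (segEmb (Nat.le_add_right n j)) (linSubst (MatIdx n) ℂ A (X (ιn ab)))
  let φ : MatIdx (n + j) → MvPolynomial (MatIdx (n + j)) ℂ :=
    fun v => if h : ∃ ab, θ ab = v then ψ h.choose else X (topMatIdx (n + j))
  have hψhom : ∀ ab, (ψ ab).IsHomogeneous 1 := fun ab =>
    (linSubst_isHomogeneous A (isHomogeneous_X ℂ (ιn ab))).rename_isHomogeneous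
  have hφhom : ∀ v, (φ v).IsHomogeneous 1 := by
    intro v
    simp only [φ]
    split_ifs with h
    · exact hψhom _
    · exact isHomogeneous_X ℂ _
  have hφθ : ∀ ab, φ (θ ab) = ψ ab := by
    intro ab
    have h : ∃ ab', θ ab' = θ ab := ⟨ab, rfl⟩
    simp only [φ, dif_pos h]
    rw [hθ h.choose_spec]
  -- both sides are `x_top^j · per_n(ψ)`
  have hinner : rename (segEmb (Nat.le_add_right n j)) (linSubst (MatIdx n) ℂ A (paddedPerFormLex ℂ n n)) =
      aeval ψ (perPoly (BlockIdx n n) ℂ) := by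
    have h0 : (X (toLex ((0 : Fin n), (0 : Fin n))) : MvPolynomial (MatIdx n) ℂ) ^ (n - n) = 1 := by
      rw [Nat.sub_self, pow_zero]
    rw [paddedPerFormLex_eq, h0, one_mul, ← AlgHom.comp_apply, ← AlgHom.comp_apply,
      show ((((rename (segEmb (Nat.le_add_right n j))).comp (linSubst (MatIdx n) ℂ A)).comp
        (rename ιn)) : MvPolynomial (BlockIdx n n × BlockIdx n n) ℂ →ₐ[ℂ] MvPolynomial (MatIdx (n + j)) ℂ) =
        aeval ψ from MvPolynomial.algHom_ext fun ab => by
          simp only [AlgHom.comp_apply, rename_X, aeval_X, ψ, ιn]]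
  have houter : aeval φ (paddedPerFormLex ℂ n (n + j)) =
      φ (toLex ((0 : Fin (n + j)), (0 : Fin (n + j)))) ^ j * aeval ψ (perPoly (BlockIdx n n) ℂ) := by
    have hj : φ (toLex ((0 : Fin (n + j)), (0 : Fin (n + j)))) ^ (n + j - n) =
        φ (toLex ((0 : Fin (n + j)), (0 : Fin (n + j)))) ^ j := by
      rw [Nat.add_sub_cancel_left]
    have hfun : ((φ ∘ fun ij : BlockIdx n (n + j) × BlockIdx n (n + j) =>
        (toLex ((ij.1 : Fin (n + j)), (ij.2 : Fin (n + j))) : MatIdx (n + j))) ∘ Prod.map e e) = ψ :=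
      funext fun ab => hφθ ab
    rw [paddedPerFormLex_eq, map_mul, map_pow, aeval_X, hj,
      ← rename_perPoly_equiv e, aeval_rename, aeval_rename, hfun]
  have hpad : φ (toLex ((0 : Fin (n + j)), (0 : Fin (n + j)))) ^ j = X (topMatIdx (n + j)) ^ j := by
    rcases Nat.eq_zero_or_pos j with hj | hj
    · subst hj
      rw [pow_zero, pow_zero]
    · have hno : ¬ ∃ ab, θ ab = toLex ((0 : Fin (n + j)), (0 : Fin (n + j))) := by
        rintro ⟨ab, hab⟩
        have h1 : ((e ab.1 : Fin (n + j)) : ℕ) = 0 := by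
          have := congrArg (fun v => ((ofLex v).1 : ℕ)) hab
          simpa [θ, ιN] using this
        have h2 := (e ab.1).2
        omega
      simp only [φ, dif_neg hno]
  have key : aeval φ (paddedPerFormLex ℂ n (n + j)) =
      paddedForm n j (linSubst (MatIdx n) ℂ A (paddedPerFormLex ℂ n n)) := by
    rw [houter, hpad, paddedForm, hinner]
  rw [← key]
  exact psl_aeval_linear_mem_endOrbit φ hφhom _


/-- **`per_n` is multilinear**: every variable has degree `≤ 1` in `paddedPerFormLex ℂ n n = per_n`
(`degreeOf_perPoly`, transported along the block renaming). [folklore] -/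
theorem psl_apply_le_one_of_mem_support_paddedPerFormLex_self (n : ℕ) [NeZero n] (v : MatIdx n) :
    ∀ e ∈ (paddedPerFormLex ℂ n n).support, e v ≤ 1 := by
  classical
  intro e he
  have h0 : (X (toLex ((0 : Fin n), (0 : Fin n))) : MvPolynomial (MatIdx n) ℂ) ^ (n - n) = 1 := by
    rw [Nat.sub_self, pow_zero]
  rw [paddedPerFormLex_eq, h0, one_mul] at he
  have hι : Function.Injective (fun ij : BlockIdx n n × BlockIdx n n =>
      (toLex ((ij.1 : Fin n), (ij.2 : Fin n)) : MatIdx n)) := by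
    intro ab ab' h
    have h' : ((ab.1 : Fin n), (ab.2 : Fin n)) = ((ab'.1 : Fin n), (ab'.2 : Fin n)) := toLex.injective h
    simp only [Prod.mk.injEq] at h'
    exact Prod.ext (Subtype.ext h'.1) (Subtype.ext h'.2)
  rw [support_rename_of_injective hι, Finset.mem_image] at he
  obtain ⟨e', he', rfl⟩ := he
  by_cases hv : v ∈ Set.range (fun ij : BlockIdx n n × BlockIdx n n =>
      (toLex ((ij.1 : Fin n), (ij.2 : Fin n)) : MatIdx n))
  · obtain ⟨ab, rfl⟩ := hv
    rw [Finsupp.mapDomain_apply hι]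
    exact (degreeOf_le_iff.mp (degreeOf_perPoly ℂ ab).le) e' he'
  · rw [Finsupp.mapDomain_notin_range _ _ hv]
    exact zero_le_one

/-- **The top-row-frozen family keeps `per_n` linear in `x_top`.**  Substituting
`x_v ↦ ∑_l A_{l v} x_l` with `A_{top, v} = 0` for `v ≠ top` (the generic matrix with its top row
frozen to `(0, …, 0, A_{top,top})`, evaluated anywhere) does not feed `x_top` into other variables,
so `A · per_n` is still linear in `x_top = x_{(n-1,n-1)}` (`∂_top² (A · per_n) = A_{tt}² A · ∂_top² per_n = 0`).
[folklore] -/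
theorem psl_apply_top_le_one_rowFrozen (n : ℕ) [NeZero n] (x : MatIdx n × MatIdx n → ℂ) :
    ∀ e ∈ (linSubst (MatIdx n) ℂ ((Matrix.of fun a b : MatIdx n =>
        if a = topMatIdx n ∧ b ≠ topMatIdx n then (0 : MvPolynomial (MatIdx n × MatIdx n) ℂ)
        else X (a, b)).map (eval x)) (paddedPerFormLex ℂ n n)).support, e (topMatIdx n) ≤ 1 := by
  classical
  apply psl_apply_le_one_of_iterPderiv_two_eq_zero
  apply psl_iterPderiv_two_linSubst_eq_zero
  · intro l hl
    rw [Matrix.map_apply, Matrix.of_apply, if_pos ⟨rfl, hl⟩, map_zero]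
  · exact psl_iterPderiv_two_eq_zero _ (psl_apply_le_one_of_mem_support_paddedPerFormLex_self n _)

/-- **EXPLICIT PADDED-PERMANENT HIGHEST-WEIGHT VECTORS WITH CERTIFIED INDEPENDENCE (axis k9).**
Let `F_i ∈ HWV_{μ*}(ℂ[Sym^n ℂ^{n²}])` be seeds of one weight `μ*` (`μ ⊢ n·d`, `ℓ(μ) ≤ n²`) whose
generic values `F_i(A · per_n)`, as polynomials in the entries of a matrix `A` WITH TOP ROW FROZEN to
`(0, …, 0, A_{top,top})`, are algebraically independent.  Then for EVERY padding `j` the classes of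
the Kadish–Landsberg / BIP lifts `liftHWV n j F_i` in `ℂ[Δ_{n+j}(X₀₀^j per_n)]`
(`OrbitCoordRing (paddedPerFormLex ℂ n (n+j)) (n+j)`) are highest-weight vectors of the single weight
`(μ♯(n+j))* = partitionWeightLex (n+j) (rowLift μ j)` and are ALGEBRAICALLY INDEPENDENT.
(`psl_seedLift_transfer` with `q₀ = per_n`, `Q = X₀₀^j per_n`, the frozen family:
`psl_apply_top_le_one_rowFrozen`, `psl_paddedForm_linSubst_per_mem_endOrbit`.)  [this file] -/
theorem psl_paddedPer_seedLift (n j : ℕ) [NeZero n] [NeZero (n + j)] {d : ℕ}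
    (μ : Nat.Partition (n * d)) (hμ : μ.parts.card ≤ n * n) {ι : Type*}
    (F : ι → MvPolynomial (DegIdx (MatIdx n) n) ℂ)
    (hF : ∀ i, F i ∈ highestWeightSpace (coordRep (MatIdx n) ℂ n) (partitionWeightLex n μ))
    (hind : AlgebraicIndependent ℂ fun i => aeval (fun ab : MatIdx n × MatIdx n =>
        if ab.1 = topMatIdx n ∧ ab.2 ≠ topMatIdx n then (0 : MvPolynomial (MatIdx n × MatIdx n) ℂ)
        else X ab) (genericOrbitMap (paddedPerFormLex ℂ n n) n (F i))) :
    (∀ i, Ideal.Quotient.mk (orbitVanishingIdeal (paddedPerFormLex ℂ n (n + j)) (n + j))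
        (liftHWV n j (F i)) ∈ highestWeightSpace (orbitCoordRep (paddedPerFormLex ℂ n (n + j)) (n + j))
          (partitionWeightLex (n + j) (rowLift μ j))) ∧
      AlgebraicIndependent ℂ fun i => Ideal.Quotient.mk
        (orbitVanishingIdeal (paddedPerFormLex ℂ n (n + j)) (n + j)) (liftHWV n j (F i)) :=
  psl_seedLift_transfer n j μ hμ (paddedPerFormLex ℂ n n) (paddedPerFormLex_isHomogeneous ℂ le_rfl)
    (paddedPerFormLex ℂ n (n + j))
    (Matrix.of fun a b : MatIdx n =>
      if a = topMatIdx n ∧ b ≠ topMatIdx n then (0 : MvPolynomial (MatIdx n × MatIdx n) ℂ) else X (a, b))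
    (psl_apply_top_le_one_rowFrozen n)
    (fun _ => psl_paddedForm_linSubst_per_mem_endOrbit n j _) F hF hind

/-- **REDUCTION OF `stub_seedRichness` TO AN `m`-FREE SEED CERTIFICATE (axis k9 of the wall
stmt-ValiantsHypothesis-12624).**  The conclusion is VERBATIM the statement of `stub_seedRichness`
(line `big-cell-semigroup-floor`, `Cruxes/ValuativeFlip/Lines/big_cell_semigroup_floor.lean`): rich
algebraically independent highest-weight families of ONE weight in `ℂ[Δ_m(X₀₀^{m-n} per_n)]` for
ALL `m ≥ n`.  The hypothesis is a statement about `per_n` ALONE (no `m`): for all large `n`, seeds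
`F₀, …, F_D ∈ HWV_{μ*}(ℂ[Sym^n ℂ^{n²}])`, `D ≥ n⁴/4`, whose generic values on the top-row-frozen
family `A · per_n` are algebraically independent polynomials in the entries of `A`.  The padded
highest-weight vectors are then the explicit lifts `liftHWV n (m-n) F_i` (`psl_paddedPer_seedLift`),
the same `D` serving every `m`.  What remains of the stub is exactly this certificate.
[this file] -/
theorem psl_seedRichness_of_seedCertificate
    (hcert : ∃ n₁ : ℕ, ∀ n ≥ n₁, ∀ [NeZero n], ∃ (d : ℕ) (μ : Nat.Partition (n * d)) (D : ℕ)
        (F : Fin (D + 1) → MvPolynomial (DegIdx (MatIdx n) n) ℂ),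
        μ.parts.card ≤ n * n ∧ n ^ 4 / 4 ≤ D ∧
        (∀ i, F i ∈ highestWeightSpace (coordRep (MatIdx n) ℂ n) (partitionWeightLex n μ)) ∧
        AlgebraicIndependent ℂ fun i => aeval (fun ab : MatIdx n × MatIdx n =>
          if ab.1 = topMatIdx n ∧ ab.2 ≠ topMatIdx n then (0 : MvPolynomial (MatIdx n × MatIdx n) ℂ)
          else X ab) (genericOrbitMap (paddedPerFormLex ℂ n n) n (F i))) :
    ∃ n₁ : ℕ, ∀ n ≥ n₁, ∀ (m : ℕ) [NeZero m], n ≤ m →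
      ∃ (ν : Weight (MatIdx m)) (D : ℕ) (F : Fin (D + 1) → OrbitCoordRing (paddedPerFormLex ℂ n m) m),
        n ^ 4 / 4 ≤ D ∧
        (∀ i, F i ∈ highestWeightSpace (orbitCoordRep (paddedPerFormLex ℂ n m) m) ν) ∧
        AlgebraicIndependent ℂ F := by
  obtain ⟨n₁, hn₁⟩ := hcert
  refine ⟨max n₁ 1, fun n hn m _ hnm => ?_⟩
  have hn1 : n₁ ≤ n := le_of_max_le_left hn
  haveI : NeZero n := ⟨by have := le_of_max_le_right hn; omega⟩
  obtain ⟨j, rfl⟩ := Nat.exists_eq_add_of_le hnm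
  obtain ⟨d, μ, D, F, hμ, hD, hF, hind⟩ := hn₁ n hn1
  obtain ⟨hHW, hAI⟩ := psl_paddedPer_seedLift n j μ hμ F hF hind
  exact ⟨_, D, _, hD, hHW, hAI⟩


/-! ### General-weight form (no partition bookkeeping): convenient for multi-weight packaging -/

open Literature.Barriers.ValiantsHypothesis (degIdxMap rename_mem_highestWeightSpace_coordRep) in
open Literature.Computability.Complexity (segEmb_strictMono isUpperSet_range_segEmb) in
/-- The lift of a highest-weight vector of ARBITRARY weight `χ` and degree `D` is a highest-weight
vector of weight `extend_segEmb χ 0 − (jD) ε_top` (inheritance along the final segment,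
`rename_mem_highestWeightSpace_coordRep`, then BIP Lemma 5.3, `innerLift_mem_highestWeightSpace`;
the partition form `(μ♯(n+j))*` of this weight is `liftHWV_mem_highestWeightSpace`).
[IP 2017 Prop. 2.6(b); BIP 2019 Lemma 5.3] -/
theorem psl_liftHWV_mem_highestWeightSpace_weight (n j : ℕ) [NeZero n] [NeZero (n + j)]
    {χ : Weight (MatIdx n)} {F : MvPolynomial (DegIdx (MatIdx n) n) ℂ} {D : ℕ}
    (hFD : F.IsHomogeneous D) (hF : F ∈ highestWeightSpace (coordRep (MatIdx n) ℂ n) χ) :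
    liftHWV n j F ∈ highestWeightSpace (coordRep (MatIdx (n + j)) ℂ (n + j))
      (Function.extend (segEmb (Nat.le_add_right n j)) χ 0 +
        Pi.single (topMatIdx (n + j)) (-(((n + j - n) * D : ℕ) : ℤ))) := by
  have hmN : n ≤ n + j := Nat.le_add_right n j
  have h1 := rename_mem_highestWeightSpace_coordRep (k := ℂ) (m := n) (segEmb_strictMono hmN)
    (isUpperSet_range_segEmb hmN) hF
  exact innerLift_mem_highestWeightSpace (k := ℂ) (topMatIdx (n + j)) (le_topMatIdx (n + j)) hmN
    (hFD.rename_isHomogeneous (f := degIdxMap (segEmb_strictMono hmN).injective)) h1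

/-- **SEED-LIFT TRANSFER, general-weight form** (same statement and proof as
`psl_seedLift_transfer`, with an arbitrary weight `χ` of size `-n d` in place of the partition
weight `μ*`; the lifted weight is `extend χ 0 − (j d) ε_top`). [this file] -/
theorem psl_seedLift_transfer_weight (n j : ℕ) [NeZero n] [NeZero (n + j)]
    (χ : Weight (MatIdx n)) (d : ℕ) (hχ : χ.size = -((n * d : ℕ) : ℤ))
    (q₀ : MvPolynomial (MatIdx n) ℂ) (hq₀ : q₀.IsHomogeneous n)
    (Q : MvPolynomial (MatIdx (n + j)) ℂ)
    {τ : Type*} (𝓐 : Matrix (MatIdx n) (MatIdx n) (MvPolynomial τ ℂ))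
    (hdeg : ∀ x : τ → ℂ, ∀ e ∈ (linSubst (MatIdx n) ℂ (𝓐.map (eval x)) q₀).support,
      e (topMatIdx n) ≤ 1)
    (hmem : ∀ x : τ → ℂ, paddedForm n j (linSubst (MatIdx n) ℂ (𝓐.map (eval x)) q₀) ∈
      endOrbit (MatIdx (n + j)) ℂ Q)
    {ι : Type*} (F : ι → MvPolynomial (DegIdx (MatIdx n) n) ℂ)
    (hF : ∀ i, F i ∈ highestWeightSpace (coordRep (MatIdx n) ℂ n) χ)
    (hind : AlgebraicIndependent ℂ fun i =>
      aeval (fun ab : MatIdx n × MatIdx n => 𝓐 ab.1 ab.2) (genericOrbitMap q₀ n (F i))) :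
    (∀ i, Ideal.Quotient.mk (orbitVanishingIdeal Q (n + j)) (liftHWV n j (F i)) ∈
        highestWeightSpace (orbitCoordRep Q (n + j))
          (Function.extend (segEmb (Nat.le_add_right n j)) χ 0 +
            Pi.single (topMatIdx (n + j)) (-(((n + j - n) * d : ℕ) : ℤ)))) ∧
      AlgebraicIndependent ℂ fun i =>
        Ideal.Quotient.mk (orbitVanishingIdeal Q (n + j)) (liftHWV n j (F i)) := by
  classical
  have hFδ : ∀ i, (F i).IsHomogeneous d := fun i =>
    isHomogeneous_of_mem_highestWeightSpace (NeZero.ne n) (hF i) hχ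
  refine ⟨fun i => psl_mk_mem_highestWeightSpace Q (n + j) _
    (psl_liftHWV_mem_highestWeightSpace_weight n j (hFδ i) (hF i)), ?_⟩
  choose c hc0 hc using fun i =>
    psl_exists_const_aeval_paddedForm_liftHWV n j χ (hF i) (hFδ i)
  refine psl_algebraicIndependent_mk_of_eval Q (n + j) (fun i => liftHWV n j (F i))
    (fun i => aeval (fun ab : MatIdx n × MatIdx n => 𝓐 ab.1 ab.2) (genericOrbitMap q₀ n (F i)))
    hind c hc0 fun x => ?_
  obtain ⟨M, hM⟩ := hmem x
  refine ⟨M, fun i => ?_⟩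
  have heval : eval x (aeval (fun ab : MatIdx n × MatIdx n => 𝓐 ab.1 ab.2)
      (genericOrbitMap q₀ n (F i))) =
      aeval (formCoeff n (linSubst (MatIdx n) ℂ (𝓐.map (eval x)) q₀)) (F i) := by
    rw [show eval x (aeval (fun ab : MatIdx n × MatIdx n => 𝓐 ab.1 ab.2)
        (genericOrbitMap q₀ n (F i))) =
        eval (fun ab : MatIdx n × MatIdx n => eval x (𝓐 ab.1 ab.2)) (genericOrbitMap q₀ n (F i)) from
      eval₂Hom_bind₁ (RingHom.id ℂ) x _ _]
    exact eval_genericOrbitMap q₀ n (F i) (𝓐.map (eval x))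
  dsimp only at hM
  rw [hM, hc i _ (linSubst_isHomogeneous _ hq₀) (hdeg x), heval]

/-- **EXPLICIT PADDED-PERMANENT HIGHEST-WEIGHT VECTORS, general-weight form.**  As
`psl_paddedPer_seedLift`, for seeds of an arbitrary common weight `χ` with `|χ| = -n d` (so they are
forms of degree `d`): the lifts are algebraically independent highest-weight vectors of
`ℂ[Δ_{n+j}(X₀₀^j per_n)]` of the one weight `extend χ 0 − (j d) ε_top`.  Weights add as functions,
so seed families of several weights are packaged into one weight by products before applying this
(`algebraicIndependent_monomial` of `ValuativeGCTValuativeFlipSeedTransfer.lean`). [this file] -/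
theorem psl_paddedPer_seedLift_weight (n j : ℕ) [NeZero n] [NeZero (n + j)]
    (χ : Weight (MatIdx n)) (d : ℕ) (hχ : χ.size = -((n * d : ℕ) : ℤ)) {ι : Type*}
    (F : ι → MvPolynomial (DegIdx (MatIdx n) n) ℂ)
    (hF : ∀ i, F i ∈ highestWeightSpace (coordRep (MatIdx n) ℂ n) χ)
    (hind : AlgebraicIndependent ℂ fun i => aeval (fun ab : MatIdx n × MatIdx n =>
        if ab.1 = topMatIdx n ∧ ab.2 ≠ topMatIdx n then (0 : MvPolynomial (MatIdx n × MatIdx n) ℂ)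
        else X ab) (genericOrbitMap (paddedPerFormLex ℂ n n) n (F i))) :
    (∀ i, Ideal.Quotient.mk (orbitVanishingIdeal (paddedPerFormLex ℂ n (n + j)) (n + j))
        (liftHWV n j (F i)) ∈ highestWeightSpace (orbitCoordRep (paddedPerFormLex ℂ n (n + j)) (n + j))
          (Function.extend (segEmb (Nat.le_add_right n j)) χ 0 +
            Pi.single (topMatIdx (n + j)) (-(((n + j - n) * d : ℕ) : ℤ)))) ∧
      AlgebraicIndependent ℂ fun i => Ideal.Quotient.mk
        (orbitVanishingIdeal (paddedPerFormLex ℂ n (n + j)) (n + j)) (liftHWV n j (F i)) :=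
  psl_seedLift_transfer_weight n j χ d hχ (paddedPerFormLex ℂ n n)
    (paddedPerFormLex_isHomogeneous ℂ le_rfl) (paddedPerFormLex ℂ n (n + j))
    (Matrix.of fun a b : MatIdx n =>
      if a = topMatIdx n ∧ b ≠ topMatIdx n then (0 : MvPolynomial (MatIdx n × MatIdx n) ℂ) else X (a, b))
    (psl_apply_top_le_one_rowFrozen n)
    (fun _ => psl_paddedForm_linSubst_per_mem_endOrbit n j _) F hF hind

/-- **REDUCTION OF `stub_seedRichness`, general-weight certificate.**  Same conclusion (verbatim
`stub_seedRichness`), hypothesis with an arbitrary weight `χ` of size `-n d` in place of a partition: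
for all large `n`, `D + 1 > n⁴/4` highest-weight vectors of ONE weight `χ` in `ℂ[Sym^n ℂ^{n²}]` whose
generic values on the top-row-frozen family `A · per_n` are algebraically independent. [this file] -/
theorem psl_seedRichness_of_weightCertificate
    (hcert : ∃ n₁ : ℕ, ∀ n ≥ n₁, ∀ [NeZero n], ∃ (χ : Weight (MatIdx n)) (d D : ℕ)
        (F : Fin (D + 1) → MvPolynomial (DegIdx (MatIdx n) n) ℂ),
        χ.size = -((n * d : ℕ) : ℤ) ∧ n ^ 4 / 4 ≤ D ∧
        (∀ i, F i ∈ highestWeightSpace (coordRep (MatIdx n) ℂ n) χ) ∧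
        AlgebraicIndependent ℂ fun i => aeval (fun ab : MatIdx n × MatIdx n =>
          if ab.1 = topMatIdx n ∧ ab.2 ≠ topMatIdx n then (0 : MvPolynomial (MatIdx n × MatIdx n) ℂ)
          else X ab) (genericOrbitMap (paddedPerFormLex ℂ n n) n (F i))) :
    ∃ n₁ : ℕ, ∀ n ≥ n₁, ∀ (m : ℕ) [NeZero m], n ≤ m →
      ∃ (ν : Weight (MatIdx m)) (D : ℕ) (F : Fin (D + 1) → OrbitCoordRing (paddedPerFormLex ℂ n m) m),
        n ^ 4 / 4 ≤ D ∧
        (∀ i, F i ∈ highestWeightSpace (orbitCoordRep (paddedPerFormLex ℂ n m) m) ν) ∧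
        AlgebraicIndependent ℂ F := by
  obtain ⟨n₁, hn₁⟩ := hcert
  refine ⟨max n₁ 1, fun n hn m _ hnm => ?_⟩
  have hn1 : n₁ ≤ n := le_of_max_le_left hn
  haveI : NeZero n := ⟨by have := le_of_max_le_right hn; omega⟩
  obtain ⟨j, rfl⟩ := Nat.exists_eq_add_of_le hnm
  obtain ⟨χ, d, D, F, hχ, hD, hF, hind⟩ := hn₁ n hn1
  obtain ⟨hHW, hAI⟩ := psl_paddedPer_seedLift_weight n j χ d hχ F hF hind
  exact ⟨_, D, _, hD, hHW, hAI⟩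

end PaddedPermanent

end

end Summit.ValiantsHypothesis.ValiantsHypothesis.Theorems.ValuativeFlip
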